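import Literature.NumberTheory.EllipticCurves.NonvanishingTwistsHoffsteinLuoProofs
import Literature.NumberTheory.EllipticCurves.QuadraticTwistKroneckerLFunctionProofs
import Literature.NumberTheory.EllipticCurves.BSDSelmerPConverse
import Literature.NumberTheory.DiophantineGeometry.ConductorExponentZeroProofs
import Literature.NumberTheory.DiophantineGeometry.ConductorFactorizationProofs
import HarnessLib

/-!
# Waldspurger's and Friedberg–Hoffstein's non-vanishing twists from Modularity and Hoffstein–Luo

The two named facts of the tree asserting a *non-vanishing* quadratic twist with prescribed
splitting for an elliptic curve `E/ℚ` of root number `−1`,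

* `Literature.NumberTheory.EllipticCurves.waldspurger_exists_heegnerField_twist_ne_zero` (Darmon 2004,
  §3.9, proof of Thm. 3.22, (1)–(3): infinitely many imaginary quadratic `K` with every `ℓ ∣ N_E`
  split and `L(E^{(d_K)}, 1) ≠ 0`), and
* `Literature.NumberTheory.EllipticCurves.friedbergHoffstein_exists_heegnerField_split_twist_ne_zero`
  (`BSDSelmerPConverse.lean`; Friedberg–Hoffstein 1995 as used by Burungale–Skinner–Tian–Wan and
  Jetchev–Skinner–Wan: the same with, in addition, a prescribed prime `p` split in `K`),

are here PROVED from

* `exists_isNewformOf` — the Modularity Theorem (Breuil–Conrad–Diamond–Taylor 2001, Thm. A, with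
  Carayol: a newform of level `N_E` with the Dirichlet coefficients of `E`), and
* `HoffsteinLuo1997_exists_twist_L_one_ne_zero` — Hoffstein–Luo 1997, Theorem, in the tree's form:
  for every `E/ℚ`, finite `S` and bound `B` a square-free `d ≡ 1 (mod 8)`, `|d| > B`, with
  `(d/ℓ) = 1` for the odd `ℓ ∈ S` and `L(E^{(d)}, 1) ≠ 0` — which carries **no** hypothesis on the
  sign of `E` and leaves the sign of `d` unspecified

(`waldspurger_exists_heegnerField_twist_ne_zero_of_hoffsteinLuo`,
`friedbergHoffstein_exists_heegnerField_split_twist_ne_zero_of_hoffsteinLuo`).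

The bridge is the **sign of the functional equation of the twist** (Murty–Murty 1997, Ch. 6, §1
and p. 96: `w(E ⊗ χ_D) = ω χ_D(−N)`, "`(1 − ω χ_D(−N)) L_D(1, f) = 0` … the requirement that
`L_D(1, f) ≠ 0` imposes a condition on `D` … `sgn D = ω (a/N)`"), proved from modularity in
`TwistFunctionalEquationModularityProofs`: for `w(E) = −1` and a *positive* odd fundamental `d`
with `(d/ℓ) = 1` for every `ℓ ∣ N_E` one has `χ_d(−1) χ_d(N_E) = 1`, so the sign of
`L(E^{(d)}, s) = L(E ⊗ χ_d, s)` (`LFunction_quadraticTwist_apply_of_int_gcd_eq_one`, from the tree's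
`WeierstrassCurve.LFunction_quadraticTwist_apply_of_emod_four_eq_one` and good reduction away from
the conductor) is `−1` and `L(E^{(d)}, 1) = 0`
(`entireLFunction_quadraticTwist_one_eq_zero_of_pos`). Hence Hoffstein–Luo's `d`, taken with `S`
containing the primes of `N_E` (and `p`), is negative — Darmon's condition (2), `ε(−1) = −1` —
and `K = ℚ(√d)` is an imaginary quadratic field of discriminant `d` in which every `ℓ ∣ N_E`
(and `p`) splits (`exists_heegnerField_iff_exists_fundamental`).

Everything here is proved; no named facts are introduced (D-0026).

## References

* [Darmon2004] H. Darmon, *Rational points on modular elliptic curves*, CBMS 101 (2004), §3.9,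
  proof of Thm. 3.22, (1)–(3).
* [HoffsteinLuo1997] J. Hoffstein, W. Luo, Math. Res. Lett. 4 (1997), Theorem (pp. 435–436).
* [MurtyMurty1997] M. R. Murty, V. K. Murty, *Non-vanishing of `L`-functions and applications*
  (1997), Ch. 6, §1 and p. 96.
* [FriedbergHoffstein1995] S. Friedberg, J. Hoffstein, Ann. of Math. 142 (1995), main theorem.
* [BCDTJAMS2001] C. Breuil, B. Conrad, F. Diamond, R. Taylor, JAMS 14 (2001), Thm. A.
* [Silverman1994] J. H. Silverman, *Advanced topics in the arithmetic of elliptic curves*, GTM 151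
  (1994), IV.10.2(a).
-/

noncomputable section

open scoped Classical NumberTheorySymbols

open WeierstrassCurve IsDedekindDomain NumberField Rat.HeightOneSpectrum
  Literature.NumberTheory.EllipticCurves.ModularForms

namespace Literature.NumberTheory.EllipticCurves

/-! ### Good reduction away from the conductor; `aₙ(E^{(D)}) = (n/|D|) aₙ(E)` for `(D, N) = 1` -/

/-- **Good reduction away from the conductor**: an elliptic `W / ℚ` has good reduction at every
finite place of `𝓞 ℚ` over a prime `p ∤ N_W` (`f_p = 0`, `factorization_conductorNorm_holds`, and
`f_p = 0 ↔` good reduction, `conductorExponent_eq_zero_iff_holds`, Silverman ATAEC IV.10.2(a);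
transported from the places of `ℤ` to those of `𝓞 ℚ` through the prime-indexed predicate,
`hasGoodReductionAtPrime_iff_hasGoodReductionAt_holds` and
`hasGoodReductionAtPrime_iff_hasGoodReductionAt_ringOfIntegers`). [cite: Silverman1994, IV.10.2(a)] -/
theorem hasGoodReductionAt_of_not_dvd_conductorNorm (W : WeierstrassCurve ℚ) [W.IsElliptic]
    (v : HeightOneSpectrum (𝓞 ℚ)) (hv : ¬ (primesEquiv v : ℕ) ∣ W.conductorNorm ℤ) :
    W.HasGoodReductionAt v := by
  set p : Nat.Primes := primesEquiv v with hp
  haveI := Fact.mk p.2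
  set vZ : HeightOneSpectrum ℤ := (primesEquiv (R := ℤ)).symm p with hvZ
  have hgen : natGenerator vZ = p :=
    congrArg (fun q : Nat.Primes ↦ (q : ℕ)) ((primesEquiv (R := ℤ)).apply_symm_apply p)
  have hf : W.conductorExponent vZ = 0 := by
    rw [← factorization_conductorNorm_holds W vZ, hgen]
    exact Nat.factorization_eq_zero_of_not_dvd hv
  have hgZ : W.HasGoodReductionAt vZ := (conductorExponent_eq_zero_iff_holds vZ W).mp hf
  have hgP : W.HasGoodReductionAtPrime p :=
    (W.hasGoodReductionAtPrime_iff_hasGoodReductionAt_holds p).mpr hgZ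
  exact (hasGoodReductionAtPrime_iff_hasGoodReductionAt_ringOfIntegers v W).mp hgP

/-- **`aₙ(E^{(D)}) = (n/|D|) aₙ(E)` for `D` an odd fundamental discriminant prime to `N_E`**
(`WeierstrassCurve.LFunction_quadraticTwist_apply_of_emod_four_eq_one` with good reduction at the
primes of `D` from `(D, N_E) = 1`; Silverman *AEC* X.2, Exercise 10.16). [cite: SilvermanAEC2009, X.2 and Exercise 10.16] -/
theorem LFunction_quadraticTwist_apply_of_int_gcd_eq_one (W : WeierstrassCurve ℚ) [W.IsElliptic]
    {D : ℤ} (hD4 : D % 4 = 1) (hsq : Squarefree D) (hgcd : Int.gcd D (W.conductorNorm ℤ) = 1)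
    (n : ℕ) : (W.quadraticTwist (D : ℚ)).LFunction n = J((n : ℤ) | D.natAbs) * W.LFunction n := by
  refine W.LFunction_quadraticTwist_apply_of_emod_four_eq_one hD4 hsq (fun v hvD ↦ ?_) n
  refine hasGoodReductionAt_of_not_dvd_conductorNorm W v fun hvN ↦ ?_
  have hp : (primesEquiv v : ℕ).Prime := (primesEquiv v).2
  have h1 : (primesEquiv v : ℕ) ∣ Int.gcd D (W.conductorNorm ℤ) := by
    show (primesEquiv v : ℕ) ∣ Nat.gcd D.natAbs ((W.conductorNorm ℤ : ℕ) : ℤ).natAbs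
    rw [Int.natAbs_natCast]
    exact Nat.dvd_gcd (Int.natCast_dvd.mp hvD) hvN
  rw [hgcd] at h1
  exact hp.one_lt.ne' (Nat.dvd_one.mp h1)

/-! ### The sign obstruction: `L(E^{(d)}, 1) = 0` for `w(E) = −1`, `d > 0` split at all `ℓ ∣ N_E` -/

/-- **The sign obstruction** (Murty–Murty 1997, Ch. 6, p. 96: "`(1 − ω χ_D(−N)) L_D(1, f) = 0` …
we require `sgn D` to be chosen so that `sgn D = ω (a/N)`"). Let `E/ℚ` be elliptic with
`w(E) = −1` and `d > 0` square-free, `d ≡ 1 (mod 4)`, with `(d/ℓ) = 1` for every odd prime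
`ℓ ∣ N_E` and `d ≡ 1 (mod 8)` if `2 ∣ N_E` (every `ℓ ∣ N_E` splits in `ℚ(√d)`). Then
`χ_d(−1) χ_d(N_E) = 1`, the functional equation of `L(E^{(d)}, s) = L(E ⊗ χ_d, s)` has sign
`w(E) χ_d(−1) χ_d(N_E) = −1`, and `L(E^{(d)}, 1) = 0` — assuming the Modularity Theorem
`exists_isNewformOf` (`entireLFunction_one_eq_zero_of_twist_sign`).
[cite: MurtyMurty1997, Ch. 6 §1, p. 96] -/
theorem entireLFunction_quadraticTwist_one_eq_zero_of_pos (hmod : exists_isNewformOf)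
    (W : WeierstrassCurve ℚ) [W.IsElliptic] (hw : W.rootNumber = -1) {d : ℤ} (hd0 : 0 < d)
    (hsq : Squarefree d) (hd4 : d % 4 = 1) (h2 : 2 ∣ W.conductorNorm ℤ → d % 8 = 1)
    (hjac : ∀ p : ℕ, p.Prime → p ∣ W.conductorNorm ℤ → p ≠ 2 → jacobiSym d p = 1) :
    (W.quadraticTwist (d : ℚ)).entireLFunction 1 = 0 := by
  set N : ℕ := W.conductorNorm ℤ with hN
  have hN0 : N ≠ 0 := (W.conductorNorm_pos_holds).ne'
  have hd2 : ¬ (2 : ℤ) ∣ d := by omega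
  have hgcd : Int.gcd d N = 1 := int_gcd_eq_one_of_forall_jacobiSym_eq_one hd2 hjac
  haveI : NeZero d.natAbs := ⟨Int.natAbs_ne_zero.mpr hsq.ne_zero⟩
  have hmd : (d.natAbs : ℤ) = d := Int.natAbs_of_nonneg hd0.le
  have hm4 : d.natAbs % 4 = 1 := by omega
  have hmodd : Odd d.natAbs := Nat.odd_iff.mpr (by omega)
  have hmsq : Squarefree d.natAbs := Int.squarefree_natAbs.mpr hsq
  have hNm : N.Coprime d.natAbs := by
    rw [Nat.Coprime, Nat.gcd_comm]
    simpa [Int.gcd] using hgcd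
  have hco : ∀ n : ℕ, ((W.quadraticTwist (d : ℚ)).LFunction n : ℂ) =
      QuadraticFields.jacobiChar d.natAbs n * (W.LFunction n : ℂ) := fun n ↦ by
    rw [LFunction_quadraticTwist_apply_of_int_gcd_eq_one W hd4 hsq hgcd n, Int.cast_mul,
      QuadraticFields.jacobiChar_natCast]
  have hχN : QuadraticFields.jacobiChar d.natAbs N = 1 :=
    QuadraticFields.jacobiChar_natAbs_natCast_eq_one_of_forall_prime hd4 hN0
      fun p hp hpN ↦ ⟨fun hp2 ↦ h2 (hp2 ▸ hpN), fun hp2 ↦ hjac p hp hpN hp2⟩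
  have hsign : (W.rootNumber : ℂ) * QuadraticFields.jacobiChar d.natAbs (-1) *
      QuadraticFields.jacobiChar d.natAbs N = -1 := by
    rw [hw, jacobiChar_neg_one_of_mod_four_eq_one hm4, hχN]
    push_cast
    ring
  exact entireLFunction_one_eq_zero_of_twist_sign W hmod hNm QuadraticFields.isQuadratic_jacobiChar
    (QuadraticFields.isPrimitive_jacobiChar hmodd hmsq) (W.quadraticTwist (d : ℚ)) hco hsign

/-- **Hoffstein–Luo's discriminant is negative when `w(E) = −1`.** For `E/ℚ` elliptic with
`w(E) = −1`, a finite set `S` of primes and a bound `B`, Hoffstein–Luo's theorem (applied with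
`S ∪ {ℓ ∣ N_E}`) and the sign obstruction give a square-free `d < 0`, `d ≡ 1 (mod 8)`, `|d| > B`,
with `(d/ℓ) = 1` for all odd `ℓ ∈ S` and all odd `ℓ ∣ N_E`, and `L(E^{(d)}, 1) ≠ 0`.
[cite: HoffsteinLuo1997, Theorem (§1, pp. 435–436)] [cite: MurtyMurty1997, Ch. 6 §1, p. 96] -/
theorem exists_neg_fundamental_twist_ne_zero_of_hoffsteinLuo (hmod : exists_isNewformOf)
    (hHL : HoffsteinLuo1997_exists_twist_L_one_ne_zero) (W : WeierstrassCurve ℚ) [W.IsElliptic]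
    (hw : W.rootNumber = -1) (S : Finset ℕ) (B : ℕ) :
    ∃ d : ℤ, d < 0 ∧ Squarefree d ∧ d % 8 = 1 ∧ B < d.natAbs ∧
      (∀ p ∈ S, p.Prime → p ≠ 2 → jacobiSym d p = 1) ∧
      (∀ p : ℕ, p.Prime → p ∣ W.conductorNorm ℤ → p ≠ 2 → jacobiSym d p = 1) ∧
      (W.quadraticTwist (d : ℚ)).entireLFunction 1 ≠ 0 := by
  have hN0 : W.conductorNorm ℤ ≠ 0 := (W.conductorNorm_pos_holds).ne'
  obtain ⟨d, hBd, hsq, hd8, -, hjac, hL⟩ := hHL W (S ∪ (W.conductorNorm ℤ).primeFactors) B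
  have hjacN : ∀ p : ℕ, p.Prime → p ∣ W.conductorNorm ℤ → p ≠ 2 → jacobiSym d p = 1 :=
    fun p hp hpN hp2 ↦ hjac p (Finset.mem_union_right _ (Nat.mem_primeFactors.mpr ⟨hp, hpN, hN0⟩)) hp hp2
  have hjacS : ∀ p ∈ S, p.Prime → p ≠ 2 → jacobiSym d p = 1 :=
    fun p hp ↦ hjac p (Finset.mem_union_left _ hp)
  have hdneg : d < 0 := by
    by_contra hd0
    push Not at hd0
    have hd0' : 0 < d := lt_of_le_of_ne hd0 (Ne.symm hsq.ne_zero)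
    exact hL (entireLFunction_quadraticTwist_one_eq_zero_of_pos hmod W hw hd0' hsq (by omega)
      (fun _ ↦ hd8) hjacN)
  exact ⟨d, hdneg, hsq, hd8, hBd, hjacS, hjacN, hL⟩

/-! ### The two named facts from Modularity and Hoffstein–Luo -/

/-- **Waldspurger's non-vanishing twist (Darmon 2004, §3.9, proof of Thm. 3.22, (1)–(3)) from the
Modularity Theorem and Hoffstein–Luo 1997.** For every elliptic `E/ℚ` with `w(E) = −1` and every
bound `B` there is an imaginary quadratic field `K` with `|d_K| > B` in which every prime dividing
`N_E` splits and with `L(E^{(d_K)}, 1) ≠ 0` — assuming `exists_isNewformOf` (BCDT 2001, Thm. A) and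
`HoffsteinLuo1997_exists_twist_L_one_ne_zero` (Hoffstein–Luo 1997, Theorem); the sign of `d` is
forced by the functional equation of the twist (Murty–Murty 1997, Ch. 6, p. 96), and the field is
`K = ℚ(√d)` (`waldspurger_exists_heegnerField_twist_ne_zero_iff_fundamental`).
[cite: Darmon2004, §3.9, proof of Thm. 3.22, (1)–(3)] [cite: HoffsteinLuo1997, Theorem (§1, pp. 435–436)]
[cite: MurtyMurty1997, Ch. 6 §1, p. 96] -/
theorem waldspurger_exists_heegnerField_twist_ne_zero_of_hoffsteinLuo (hmod : exists_isNewformOf)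
    (hHL : HoffsteinLuo1997_exists_twist_L_one_ne_zero) :
    waldspurger_exists_heegnerField_twist_ne_zero := by
  rw [waldspurger_exists_heegnerField_twist_ne_zero_iff_fundamental]
  intro W _ hw B
  obtain ⟨d, hdneg, hsq, hd8, hBd, -, hjacN, hL⟩ :=
    exists_neg_fundamental_twist_ne_zero_of_hoffsteinLuo hmod hHL W hw ∅ B
  exact ⟨d, hdneg, Or.inl ⟨by omega, hsq, by omega⟩, hBd,
    fun p hp hpN ↦ ⟨fun _ ↦ hd8, fun hp2 ↦ hjacN p hp hpN hp2⟩, hL⟩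

/-- **Friedberg–Hoffstein's non-vanishing twist with a prescribed split prime, from the Modularity
Theorem and Hoffstein–Luo 1997.** For every elliptic `E/ℚ` with `w(E) = −1`, every prime `p` and
every bound `B` there is an imaginary quadratic field `K` with `|d_K| > B` in which every prime
dividing `N_E` splits, `p` splits, and `L(E^{(d_K)}, 1) ≠ 0`: the named fact
`friedbergHoffstein_exists_heegnerField_split_twist_ne_zero` (`BSDSelmerPConverse.lean`;
Friedberg–Hoffstein 1995 as used by Burungale–Skinner–Tian–Wan 2024, proof of Thm. 4.3, and
Jetchev–Skinner–Wan 2017, §7.4) from `exists_isNewformOf` and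
`HoffsteinLuo1997_exists_twist_L_one_ne_zero` (Hoffstein–Luo's "moreover" clause with `p`
adjoined to `S`; `K = ℚ(√d)` with `d < 0` by the sign obstruction, and the Heegner hypothesis for
`N_E · p`, `exists_heegnerField_iff_exists_fundamental`, split into its two factors).
[cite: HoffsteinLuo1997, Theorem (§1, pp. 435–436)] [cite: MurtyMurty1997, Ch. 6 §1, p. 96]
[cite: FriedbergHoffstein1995, main theorem] -/
theorem friedbergHoffstein_exists_heegnerField_split_twist_ne_zero_of_hoffsteinLuo
    (hmod : exists_isNewformOf) (hHL : HoffsteinLuo1997_exists_twist_L_one_ne_zero) :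
    friedbergHoffstein_exists_heegnerField_split_twist_ne_zero := by
  intro W _ hw p hp B
  obtain ⟨d, hdneg, hsq, hd8, hBd, hjacS, hjacN, hL⟩ :=
    exists_neg_fundamental_twist_ne_zero_of_hoffsteinLuo hmod hHL W hw {p} B
  have hkr : ∀ q : ℕ, q.Prime → q ∣ W.conductorNorm ℤ * p →
      (q = 2 → d % 8 = 1) ∧ (q ≠ 2 → jacobiSym d q = 1) := by
    intro q hq hqNp
    refine ⟨fun _ ↦ hd8, fun hq2 ↦ ?_⟩
    rcases (Nat.Prime.dvd_mul hq).mp hqNp with hqN | hqp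
    · exact hjacN q hq hqN hq2
    · have hqp' : q = p := (Nat.prime_dvd_prime_iff_eq hq hp).mp hqp
      rw [hqp'] at hq2 ⊢
      exact hjacS p (Finset.mem_singleton_self p) hp hq2
  obtain ⟨K, _, _, hK, hB, hH, hLK⟩ :=
    (exists_heegnerField_iff_exists_fundamental (W.conductorNorm ℤ * p) B
      (fun D ↦ (W.quadraticTwist (D : ℚ)).entireLFunction 1 ≠ 0)).mpr
      ⟨d, hdneg, Or.inl ⟨by omega, hsq, by omega⟩, hBd, hkr, hL⟩
  exact ⟨K, _, _, hK, hB, hH.of_dvd (dvd_mul_right _ _), hH.of_dvd (dvd_mul_left _ _), hLK⟩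

end Literature.NumberTheory.EllipticCurves

end
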